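import Mathlib
import HarnessLib
import Summits.HubbardSuperconductivity.HubbardSuperconductivity.Theorems.KLProgrammeKLRegimeEngineTowerRemeasureNarrowWideSplitWt

/-!
# Route `KLProgramme` — crux K3 ENGINE (stmt-HubbardSuperconductivity-20437 `KLRegimeEngineV17F2`), stub (b) v2, THE LEVELS PACKAGE (ℓ), (I2) weighted track:
# THE WEIGHTED ALL-KNOWN BORN ARRAY `klTowerBornWtFull` — the on-class datum of the weighted re-measurement (located item «(I2)-WT-ONCLASS», cure (α′),
# plan g22 (R165): «b₂ := the WEIGHTED ALL-KNOWN born array»; carrier name by the pen, E1 may rename; cell gate-hubbard-kl, seat hubbard-kl-k3c2-p3 g11)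

The kit `towerBorn_le_law_split` is currency-blind; its `hμ` pays the on-class (umklapp-narrow) part of the re-measurement by the ALL-KNOWN track `b₂` with the level
gain `h^{k′}`.  On the WEIGHTED track the measured array is a weighted pinned sum, which no plain norm bounds (`klScaleWt` is unbounded on the torus), so `b₂` must be
instantiated in the WEIGHTED all-known currency: the single-tuple weighted pinned sums of the increment `Δ_k = klTowerIncr … d k` at its born family `F_{dk}`, weight
at the BORN rate `dk` ((K4): every finer rate's weight is smaller, `klScaleWt_le_of_le`).  This file names that array and instantiates the weighted narrow / wide row on it:

* §1 **`klTowerBornWtFull L M β U μ K d k m`** — `⨆` over (pinned leg `q`, label tuple `σ′`, pin `y`) of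
  `ε^{m−1}·Σ_{x : x q = y} klScaleWt (dk) (pos x)·‖W^{F_{dk}}(Δ_k)(σ′, x)‖`; `klTowerBornWtFull_nonneg`; `pinnedTupleWtSum_le_klTowerBornWtFull` (the `le_ciSup` row, degree
  `m+1`); `pinnedTupleWtSum_rate_le_klTowerBornWtFull` (any rate `j ≥ dk`);
* §2 **`klWtPinnedSumAt_klTowerIncr_narrowWideSplit_le_klEng_flow_deep dd m (3 ≤ m)`** — `Δ_{k′}` re-measured at `F_{dk−1}`, rate `j ≥ dk−1`, at the flow frame on
  the deep window, narrow / wide split: off-class datum `klTowerBornWtAt … d k′ j (m+1)` (E1's rate-`j` weighted born array), on-class datum `klTowerBornWtFull … d k′ (m+1)`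
  × the narrow multiplicity — the weighted twin of `klLevNormOf_klTowerIncr_narrowWideSplit_le_klEng` (p620695).
The supplier of this array's law (`hstep₂` on the weighted track) is the WEIGHTED + PRESCRIBED block door (DOOR-SPEC in HOME/hubbard-kl-k3c2-p3/ONCLASS-CONSUMER.md §4;
door lane).  One definition with body + closed rows; nothing about the model is asserted; nothing asserts superconductivity.
References: BGM 2006 §2.8 (2.76)–(2.77), (2.82)–(2.84), (2.88)–(2.90), App. A3 [cite: BenfattoGiulianiMastropietro2006].
-/

noncomputable section

namespace Summit.HubbardSuperconductivity.HubbardSuperconductivity.Theorems.EngineV8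

set_option linter.dupNamespace false -- summit = problem name (single-conjunct summit), D-0017

open Classical
open Real Finset Literature.MathematicalPhysics.QuantumLattice Literature.Probability.LatticeModels GrassmannAlgebra
open Literature.MathematicalPhysics.QuantumLattice.FermiRG
open Summit.HubbardSuperconductivity.HubbardSuperconductivity.Theorems.KLRegimeSplit
open Summit.HubbardSuperconductivity.HubbardSuperconductivity.Theorems.KLProgrammeLegKernels
open Summit.HubbardSuperconductivity.HubbardSuperconductivity.Theorems.DispersionFlow
open Summit.HubbardSuperconductivity.HubbardSuperconductivity.Theorems.PerturbedFermiCurve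

/-! ## §1 The weighted all-known born array -/

section Carrier

variable (L M : ℕ) [NeZero L] [NeZero M]

/-- **`klTowerBornWtFull L M β U μ K d k m`** — the WEIGHTED ALL-KNOWN born size of block `k`: the supremum over the pinned leg `q`, the full label tuple `σ′`
(family `F_{dk}`) and the pin `y` of the single-tuple weighted pinned sum `ε^{m−1}·Σ_{x : x q = y} klScaleWt L M β (dk) (pos x)·‖sectorisedKernel … F_{dk} Δ_k m σ′ x‖`
(weight at the born rate `dk`; the on-class datum `N_f` of `klWtPinnedSumAt_jump_le_narrowWideSplit_klEng_flow_deep`, i.e. the `b₂` array of the kit on the weighted track,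
before normalisation by units and level gain). -/
def klTowerBornWtFull (β U μ : ℝ) (K : TrigPolyC4v) (d k m : ℕ) : ℝ :=
  ⨆ t : Fin m × (Fin m → SectorLeg (sectorCount (d * k))) × SpaceTimeIdx L M,
    imagTimeWeight β M ^ (m - 1) *
      ∑ x' ∈ univ.filter (fun x' : Fin m → SpaceTimeIdx L M => x' t.1 = t.2.2),
        klScaleWt L M β (d * k) ((univ.image x').image (fun x : SpaceTimeIdx L M => (((((2 * (x.1 : ℕ) : ℕ)) : ZMod (2 * (2 * M)))), x.2))) *
          ‖sectorisedKernel L M β (klAnisoFamily L M β μ K klE0 (d * k)) (klTowerIncr L M β U μ K d k) m t.2.1 x'‖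

variable {L M}

omit [NeZero M] in
/-- `0 ≤ klTowerBornWtFull …` (`0 ≤ β`). -/
theorem klTowerBornWtFull_nonneg {β : ℝ} (hβ : 0 ≤ β) (U μ : ℝ) (K : TrigPolyC4v) (d k m : ℕ) : 0 ≤ klTowerBornWtFull L M β U μ K d k m := by
  unfold klTowerBornWtFull
  rcases isEmpty_or_nonempty (Fin m × (Fin m → SectorLeg (sectorCount (d * k))) × SpaceTimeIdx L M) with h | h
  · rw [Real.iSup_of_isEmpty]
  · refine le_ciSup_of_le (Set.finite_range _).bddAbove (Classical.arbitrary _) ?_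
    have hε : 0 ≤ imagTimeWeight β M := imagTimeWeight_nonneg hβ M
    exact mul_nonneg (pow_nonneg hε _) (sum_nonneg fun _ _ => mul_nonneg (le_trans zero_le_one (one_le_klScaleWt L M β _ _)) (norm_nonneg _))

omit [NeZero M] in
/-- **Every single-tuple weighted pinned sum of `Δ_k` at its born family and born rate is at most `klTowerBornWtFull`** (degree `m + 1`, the `le_ciSup` row). -/
theorem pinnedTupleWtSum_le_klTowerBornWtFull (β U μ : ℝ) (K : TrigPolyC4v) (d k m : ℕ) (q : Fin (m + 1))
    (σ' : Fin (m + 1) → SectorLeg (sectorCount (d * k))) (y : SpaceTimeIdx L M) :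
    imagTimeWeight β M ^ m *
        ∑ x' ∈ univ.filter (fun x' : Fin (m + 1) → SpaceTimeIdx L M => x' q = y),
          klScaleWt L M β (d * k) ((univ.image x').image (fun x : SpaceTimeIdx L M => (((((2 * (x.1 : ℕ) : ℕ)) : ZMod (2 * (2 * M)))), x.2))) *
            ‖sectorisedKernel L M β (klAnisoFamily L M β μ K klE0 (d * k)) (klTowerIncr L M β U μ K d k) (m + 1) σ' x'‖ ≤
      klTowerBornWtFull L M β U μ K d k (m + 1) :=
  le_ciSup (f := fun t : Fin (m + 1) × (Fin (m + 1) → SectorLeg (sectorCount (d * k))) × SpaceTimeIdx L M =>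
    imagTimeWeight β M ^ (m + 1 - 1) *
      ∑ x' ∈ univ.filter (fun x' : Fin (m + 1) → SpaceTimeIdx L M => x' t.1 = t.2.2),
        klScaleWt L M β (d * k) ((univ.image x').image (fun x : SpaceTimeIdx L M => (((((2 * (x.1 : ℕ) : ℕ)) : ZMod (2 * (2 * M)))), x.2))) *
          ‖sectorisedKernel L M β (klAnisoFamily L M β μ K klE0 (d * k)) (klTowerIncr L M β U μ K d k) (m + 1) t.2.1 x'‖)
    (Set.finite_range _).bddAbove (q, σ', y)

omit [NeZero M] in
/-- **The same at any finer rate `j ≥ dk`** (the weight decreases with the rate index, `klScaleWt_le_of_le`): the single-tuple weighted pinned sum of `Δ_k` with weight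
`klScaleWt … j` is at most `klTowerBornWtFull … d k (m+1)` (`0 ≤ β`). -/
theorem pinnedTupleWtSum_rate_le_klTowerBornWtFull {β : ℝ} (hβ : 0 ≤ β) (U μ : ℝ) (K : TrigPolyC4v) (d k m : ℕ) {j : ℕ} (hj : d * k ≤ j)
    (q : Fin (m + 1)) (σ' : Fin (m + 1) → SectorLeg (sectorCount (d * k))) (y : SpaceTimeIdx L M) :
    imagTimeWeight β M ^ m *
        ∑ x' ∈ univ.filter (fun x' : Fin (m + 1) → SpaceTimeIdx L M => x' q = y),
          klScaleWt L M β j ((univ.image x').image (fun x : SpaceTimeIdx L M => (((((2 * (x.1 : ℕ) : ℕ)) : ZMod (2 * (2 * M)))), x.2))) *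
            ‖sectorisedKernel L M β (klAnisoFamily L M β μ K klE0 (d * k)) (klTowerIncr L M β U μ K d k) (m + 1) σ' x'‖ ≤
      klTowerBornWtFull L M β U μ K d k (m + 1) := by
  have hε : 0 ≤ imagTimeWeight β M := imagTimeWeight_nonneg hβ M
  refine le_trans (mul_le_mul_of_nonneg_left (sum_le_sum fun x' _ => ?_) (pow_nonneg hε m))
    (pinnedTupleWtSum_le_klTowerBornWtFull β U μ K d k m q σ' y)
  exact mul_le_mul_of_nonneg_right (klScaleWt_le_of_le β hj _) (norm_nonneg _)

end Carrier

/-! ## §2 The weighted narrow / wide row on the tower's arrays -/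

variable {L M : ℕ} [NeZero L] [NeZero M]

/-- **THE INCREMENT `Δ_{k′}` RE-MEASURED AT `F_{dk−1}` (weighted track, rate `j ≥ dk−1`, flow frame, deep window), NARROW / WIDE SPLIT, ON THE TOWER'S ARRAYS**:
off the class E1's rate-`j` weighted born array `klTowerBornWtAt … d k′ j (m+1)`, on the narrow class the weighted all-known array `klTowerBornWtFull … d k′ (m+1)` times
the narrow multiplicity (`m + 1 ≥ 4` legs). [cite: BenfattoGiulianiMastropietro2006, §2.8 (2.82)-(2.84), (2.88)-(2.90), App. A3] -/
theorem klWtPinnedSumAt_klTowerIncr_narrowWideSplit_le_klEng_flow_deep (dd m : ℕ) (hm : 3 ≤ m) :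
    ∃ Cm : ℝ, 0 < Cm ∧ ∃ C : ℝ, 0 < C ∧ ∃ D₁ : ℝ, 0 < D₁ ∧ ∃ Cw : ℝ, 0 < Cw ∧
      ∃ c₂ cb K₁ K₂ c₀ c₂' : ℝ, 0 ≤ c₂ ∧ 0 < cb ∧ 2 + c₂ ≤ K₁ ∧ 0 < K₂ ∧ 0 < c₀ ∧ 0 < c₂' ∧
      ∃ D₂ : ℝ, 0 < D₂ ∧ ∃ k₀ : ℕ,
      ∀ R : RenConsts, R.WF2 → ∃ c₃ : ℝ, 0 < c₃ ∧ ∃ U₀ : ℝ, 0 < U₀ ∧ ∃ Λ : ℝ, 0 ≤ Λ ∧ ∃ r₀ : ℝ, 0 < r₀ ∧ ∃ v₀ : ℝ, 0 < v₀ ∧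
      ∀ (G : GeoConsts) (P : SplitConsts) (Q : EngConsts) (cc : ℝ), 0 < cc → cc ≤ klEngC₃6 P R → cc ≤ c₃ →
      ∀ μ ∈ klWindowC, ∀ U : ℝ, 0 < U → U ≤ min (klEngU₀3 P R cc) (1 / (R.Gfr 3 + 1)) → U ≤ U₀ →
      ∀ β : ℝ, klBetaMin ≤ β → β ≤ Real.exp (cc / U ^ 2) →
      ∀ (L M : ℕ) [NeZero L] [NeZero M], klEngL₃ β U ≤ L → klEngM₃ β U L ≤ M →
      ∀ n : ℕ, 1 ≤ n → n ≤ nScales β + 1 →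
        HistP klPredsV17F2 L M G P Q R β U μ 0 n → FrameOK R U (nScales β) μ (klFlowFrameU L M β U μ n) →
        ∀ d k k' : ℕ, 2 ≤ d → k' < k → k₀ ≤ d * k' → d * k - 1 ≤ n → (4 : ℝ) ^ n * U ≤ (4 : ℝ) ^ (2 * (d * k' + 1) + dd) →
      ∀ (Θ LΨ Bfib : ℝ), LΨ = (m + 1 : ℕ) + c₂ * (π / 2 + 5 * sectorWidth (d * k')) / (K₁ * Θ) → (2 : ℝ) ^ (-((d * k - 1 : ℕ) : ℤ)) ≤ Θ →
        cb * (2 : ℝ) ^ (-((d * k - 1 : ℕ) : ℤ)) ≤ Θ → K₂ * LΨ * (cb * (2 : ℝ) ^ (-((d * k - 1 : ℕ) : ℤ))) ≤ c₂' * Θ →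
        max ((2 * ((2 * c₀ * K₂ * cb / π + 1) * LΨ)) ^ 2) (4 * cb ^ 2 * K₂ ^ 2 / 1 ^ 2 * LΨ ^ 2) ≤ Bfib →
      ((m : ℝ) + 1) * (Cw + C) * sectorWidth (d * k') < 2 * π →
      (((m : ℝ) + 1) * C + m * Λ * (⌊(Θ + 5 * sectorWidth (d * k')) / sectorWidth (d * k')⌋₊ : ℕ)) * sectorWidth (d * k') < v₀ →
      ((m : ℝ) + 1) * C * sectorWidth (d * k') < π →
        ∀ j : ℕ, d * k - 1 ≤ j → ∀ (q : Fin (m + 1)) (w : SpaceTimeIdx L M × SectorLeg (sectorCount (d * k - 1))),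
          klWtPinnedSumAt L M β μ (klFlowFrameU L M β U μ n) (d * k - 1) j (m + 1) (klTowerIncr L M β U μ (klFlowFrameU L M β U μ n) d k') q w ≤
            Cm * ((27 : ℝ) * (D₁ ^ (m + 1) + (5 : ℝ) ^ (m + 1) * ((m + 1 : ℕ) ^ 2 * (Bfib * 3 ^ (m - 2)))) * ((2 : ℝ) ^ (d * k - 1 - d * k')) ^ (m - 2) *
                klTowerBornWtAt L M β U μ (klFlowFrameU L M β U μ n) d k' j (m + 1) +
              D₂ * 27 ^ (m + 1) * ((2 : ℝ) ^ (d * k - 1 - d * k')) ^ (m - 1) *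
                ((2 * ((m : ℝ) + 1) + 1) ^ 2 * (2 * (8 * π * (((m : ℝ) + 1) * C + m * Λ *
                  (⌊(Θ + 5 * sectorWidth (d * k')) / sectorWidth (d * k')⌋₊ : ℕ)) / r₀ + 2) *
                  (8 * (2 * ((⌊(Θ + 5 * sectorWidth (d * k')) / sectorWidth (d * k')⌋₊ : ℕ) : ℝ) + 1)) ^ m)) *
                klTowerBornWtFull L M β U μ (klFlowFrameU L M β U μ n) d k' (m + 1)) := by
  obtain ⟨Cm, hCm, C, hC, D₁, hD₁, Cw, hCw, c₂, cb, K₁, K₂, c₀, c₂', h1, h2, h3, h4, h5, h6, D₂, hD₂, k₀, h⟩ :=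
    klWtPinnedSumAt_jump_le_narrowWideSplit_klEng_flow_deep dd m hm
  refine ⟨Cm, hCm, C, hC, D₁, hD₁, Cw, hCw, c₂, cb, K₁, K₂, c₀, c₂', h1, h2, h3, h4, h5, h6, D₂, hD₂, k₀, fun R hR2 => ?_⟩
  obtain ⟨c₃, hc₃, U₀, hU₀, Λ, hΛ, r₀, hr₀, v₀, hv₀, h'⟩ := h R hR2
  refine ⟨c₃, hc₃, U₀, hU₀, Λ, hΛ, r₀, hr₀, v₀, hv₀, ?_⟩
  intro G P Q cc hcc hcc6 hccm μ hμ U hU hUle hUm β hβmin hβc L M _ _ hL3 hM3 n hn1 hnN hhist hfr d k k' hd hk hk₀ hkn hwin Θ LΨ Bfib hLΨ hΘt hΘδ hΘη hBfib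
    hsmall hsmallv hπC j hj q w
  have hβ : 0 < β := KLRegimeSplit.pos_of_klBetaMin_le hβmin
  have hjk : d * k' ≤ j := by have := block_jump_le hd hk; omega
  exact h' G P Q cc hcc hcc6 hccm μ hμ U hU hUle hUm β hβmin hβc L M hL3 hM3 n hn1 hnN hhist hfr (d * k') (d * k - 1) hk₀ (block_jump_le hd hk) hkn hwin
    Θ LΨ Bfib hLΨ hΘt hΘδ hΘη hBfib hsmall hsmallv hπC (klTowerIncr L M β U μ _ d k') (fun m' X hX => klTowerIncr_momentumConserving β U μ _ d k' m' X hX)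
    j hj q w (klTowerBornWtAt L M β U μ _ d k' j (m + 1)) (klTowerBornWtFull L M β U μ _ d k' (m + 1))
    (klTowerBornWtAt_nonneg hβ.le U μ _ d k' j (m + 1)) (klTowerBornWtFull_nonneg hβ.le U μ _ d k' (m + 1))
    (fun w' => klWtPinnedSumAt_le_klTowerBornWtAt β U μ _ d k' j (m + 1) q w')
    (fun σ' y' => pinnedTupleWtSum_rate_le_klTowerBornWtFull hβ.le U μ _ d k' m hjk q σ' y')

end Summit.HubbardSuperconductivity.HubbardSuperconductivity.Theorems.EngineV8

end
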